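import Mathlib
import Summits.Ventures.PercRepro.TriangleCapCapCounts

/-!
# PercRepro — THE CAP CASE OF THE ROW `a = 3` AT SECOND ORDER: a `K₄⁻`-free graph on the cell `(k, 3, r)`
with a vertex of degree `k − 3` is a spanning subgraph of some `K(A, Aᶜ)`, `|A| = 3`, or at least `2 (k − 7)`
below the closed form (p3, gen 43; part 190b)

Let `x` have degree `k − 3`, `N = N(x)` and `R = {u, v}` the two non-neighbours. By `K₄⁻`-freeness `N` induces a
matching of `M` edges (`degIn N ≤ 1`, part 154), `u` and `v` are adjacent to at most one end of each matching
edge (`two_mul_degIn_add_adjPairs_le`: `P_u := degIn N u ≤ k − 3 − M`), and the degrees read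
`d(y) = 1 + f(y) + g(y)` on `N` (`f = degIn N ∈ {0, 1}`, `g = degIn R ∈ {0, 1, 2}`), `d(u) = P_u + [u ∼ v]`.
The sums: `Σ_N f = 2M` (`adjPairs_eq_two_mul`), `Σ_N g = P_u + P_v`, `Σ_N g² = Σ_N g + 2c`, `Σ_N f g ≤ 2M`
(part 190a). With the edge count `m = (k − 3) + M + P_u + P_v + [u ∼ v]`:
* `u ≁ v`: if `M = 0` then `D ⊆ K({x, u, v}, N)`; if `M ≥ 1` the gap is `≥ M (2k − 13 − M) ≥ 2k − 14`
  (`three_row_cap_arith_not_adj`);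
* `u ∼ v`: `c ≤ 1` and `P_u + P_v ≤ k − 2` force `M ≥ 2`, and the gap is `≥ M (2k − 11 − M) − 2r ≥ 2k − 14`
  (`three_row_cap_arith_adj`).
`three_row_cap` is the case (A) of §10bu(b). Axioms: standard.
-/

namespace PercRepro

namespace TriangleCap

namespace C047

open Finset

variable {V : Type*} [Fintype V] [DecidableEq V]

set_option maxHeartbeats 400000 in
/-- **THE CAP CASE OF THE ROW `a = 3` AT SECOND ORDER:** on the cell `m + 9 + r = 3k`, `r + 7 ≤ k`, a `K₄⁻`-free
graph with a vertex of degree `k − 3` is a spanning subgraph of some `K(A, Aᶜ)` with `|A| = 3`, or `r ≥ 1` and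
`Σ_v d(v)² + r (k − 1 − r) + 2 (k − 7) ≤ m k`. -/
theorem three_row_cap (D : SimpleGraph V) [DecidableRel D.Adj] (hK : K4mFree D) (r : ℕ)
    (hk : r + 7 ≤ Fintype.card V) (hm : D.edgeFinset.card + 9 + r = 3 * Fintype.card V)
    (x : V) (hx : deg D x + 3 = Fintype.card V) :
    (∃ A : Finset V, A.card = 3 ∧ BipSub D A) ∨
      (1 ≤ r ∧ ∑ v, deg D v * deg D v + r * (Fintype.card V - 1 - r) + 2 * (Fintype.card V - 7) ≤
        D.edgeFinset.card * Fintype.card V) := by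
  obtain ⟨N, hN⟩ : ∃ N : Finset V, N = univ.filter (fun w => D.Adj x w) := ⟨_, rfl⟩
  have hmemN : ∀ w, w ∈ N ↔ D.Adj x w := fun w => by rw [hN, mem_filter]; simp only [mem_univ, true_and]
  have hxN : x ∉ N := fun h => D.irrefl ((hmemN x).mp h)
  have hdx : deg D x = N.card := by rw [hN]; rfl
  obtain ⟨K, hKdef⟩ : ∃ K, N.card = K := ⟨_, rfl⟩
  have hcardV : Fintype.card V = K + 3 := by omega
  obtain ⟨s, hs⟩ : ∃ s, K = r + 4 + s := ⟨K - r - 4, by omega⟩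
  have hsub1 : Fintype.card V - 1 - r = s + 6 := by omega
  have hsub2 : Fintype.card V - 7 = r + s := by omega
  -- the two non-neighbours
  obtain ⟨R, hR⟩ : ∃ R : Finset V, R = (insert x N)ᶜ := ⟨_, rfl⟩
  have hRcard : R.card = 2 := by
    rw [hR, card_compl, card_insert_of_notMem hxN]
    omega
  obtain ⟨u, v, huv, hRuv⟩ := card_eq_two.mp hRcard
  have hmemR : ∀ w, w ∈ R ↔ w ≠ x ∧ ¬ D.Adj x w := by
    intro w
    rw [hR, mem_compl, mem_insert, hmemN]
    tauto
  have hu : u ≠ x ∧ ¬ D.Adj x u := (hmemR u).mp (by rw [hRuv]; exact mem_insert_self u {v})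
  have hv : v ≠ x ∧ ¬ D.Adj x v := (hmemR v).mp (by rw [hRuv]; exact mem_insert_of_mem (mem_singleton_self v))
  -- the matching inside `N`
  obtain ⟨M, hM⟩ : ∃ M, adjPairs D N = 2 * M := ⟨_, adjPairs_eq_two_mul D N⟩
  have hf1 : ∀ y ∈ N, degIn D N y ≤ 1 := fun y hy => by rw [hN]; exact degIn_nbhd_le_one D hK ((hmemN y).mp hy)
  have hTf : ∑ y ∈ N, degIn D N y = 2 * M := by rw [← adjPairs_eq_sum_degIn, hM]
  have h2MK : 2 * M ≤ K := by
    have := adjPairs_nbhd_le D hK x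
    rw [← hN, hM, hKdef] at this
    exact this
  -- the neighbours of `u`, `v` in `N`
  have hPu : 2 * degIn D N u + 2 * M ≤ 2 * K := by
    have := two_mul_degIn_add_adjPairs_le D hK (x := x) hu.1
    rw [← hN, hM, hKdef] at this
    exact this
  have hPv : 2 * degIn D N v + 2 * M ≤ 2 * K := by
    have := two_mul_degIn_add_adjPairs_le D hK (x := x) hv.1
    rw [← hN, hM, hKdef] at this
    exact this
  -- the degrees
  have hdegN : ∀ y ∈ N, deg D y = 1 + degIn D N y + degIn D {u, v} y := by
    intro y hy
    have := deg_eq_of_mem_nbhd D x y ((hmemN y).mp hy)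
    rw [← hN, ← hR, hRuv] at this
    exact this
  have hdegu : deg D u = degIn D N u + degIn D {u, v} u := by
    have := deg_eq_of_not_mem_nbhd D x u hu.2
    rw [← hN, ← hR, hRuv] at this
    exact this
  have hdegv : deg D v = degIn D N v + degIn D {u, v} v := by
    have := deg_eq_of_not_mem_nbhd D x v hv.2
    rw [← hN, ← hR, hRuv] at this
    exact this
  have hRu : degIn D {u, v} u = if D.Adj u v then 1 else 0 := by
    rw [degIn_pair D huv, if_neg D.irrefl, zero_add]
  have hRv : degIn D {u, v} v = if D.Adj u v then 1 else 0 := by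
    rw [degIn_pair D huv, if_neg D.irrefl, add_zero]
    by_cases h : D.Adj u v
    · rw [if_pos (D.adj_symm h), if_pos h]
    · rw [if_neg (fun h' => h (D.adj_symm h')), if_neg h]
  -- the sums over `N`
  have hTg : ∑ y ∈ N, degIn D {u, v} y = degIn D N u + degIn D N v := by
    rw [sum_degIn_comm D N {u, v}, sum_pair huv]
  obtain ⟨c, hc⟩ : ∃ c, (N.filter (fun y => D.Adj y u ∧ D.Adj y v)).card = c := ⟨_, rfl⟩
  have hTgg := sum_degIn_pair_sq D huv N
  rw [hc] at hTgg
  have hc1 : c ≤ degIn D N u := by rw [← hc]; exact card_both_le_degIn D u v N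
  have hc2 : c ≤ degIn D N v := by rw [← hc]; exact card_both_le_degIn' D u v N
  have hTfg : ∑ y ∈ N, degIn D N y * degIn D {u, v} y ≤ 2 * M := by
    have := sum_degIn_mul_degIn_pair_le D hK x u v huv hu.1 hv.1
    rw [← hN, hM] at this
    exact this
  have hsqN : ∑ y ∈ N, deg D y * deg D y =
      K + 3 * (2 * M) + (∑ y ∈ N, degIn D {u, v} y + 2 * c) + 2 * (degIn D N u + degIn D N v) +
        2 * ∑ y ∈ N, degIn D N y * degIn D {u, v} y := by
    have hexp : ∀ y ∈ N, deg D y * deg D y =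
        1 + 3 * degIn D N y + degIn D {u, v} y * degIn D {u, v} y + 2 * degIn D {u, v} y +
          2 * (degIn D N y * degIn D {u, v} y) := by
      intro y hy
      rw [hdegN y hy]
      exact sq_one_add_add _ _ (mul_self_of_le_one (hf1 y hy))
    rw [sum_congr rfl hexp, sum_add_distrib, sum_add_distrib, sum_add_distrib, sum_add_distrib,
      sum_const, smul_eq_mul, mul_one, hKdef, ← mul_sum, hTf, hTgg, ← mul_sum, hTg, ← mul_sum]
  -- the degree sum and the square sum split over `{x} ∪ N ∪ {u, v}`
  have hsplit : ∀ F : V → ℕ, ∑ w, F w = F x + ∑ y ∈ N, F y + (F u + F v) := by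
    intro F
    rw [← sum_add_sum_compl (insert x N), sum_insert hxN, ← hR, hRuv, sum_pair huv]
  have hdegsum := sum_deg_eq D
  rw [hsplit] at hdegsum
  have hsumN : ∑ y ∈ N, deg D y = K + 2 * M + (degIn D N u + degIn D N v) := by
    rw [sum_congr rfl hdegN, sum_add_distrib, sum_add_distrib, sum_const, smul_eq_mul, mul_one, hKdef, hTf, hTg]
  rw [hsumN, hdx, hKdef, hdegu, hdegv, hRu, hRv] at hdegsum
  have hsq := hsplit (fun w => deg D w * deg D w)
  simp only at hsq
  rw [hsqN, hdx, hKdef, hdegu, hdegv, hRu, hRv] at hsq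
  -- everything as plain numbers
  obtain ⟨Pu, hPudef⟩ : ∃ P, degIn D N u = P := ⟨_, rfl⟩
  obtain ⟨Pv, hPvdef⟩ : ∃ P, degIn D N v = P := ⟨_, rfl⟩
  obtain ⟨Tg, hTgdef⟩ : ∃ T, ∑ y ∈ N, degIn D {u, v} y = T := ⟨_, rfl⟩
  obtain ⟨Tfg, hTfgdef⟩ : ∃ T, ∑ y ∈ N, degIn D N y * degIn D {u, v} y = T := ⟨_, rfl⟩
  obtain ⟨m, hmdef⟩ : ∃ m, D.edgeFinset.card = m := ⟨_, rfl⟩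
  obtain ⟨SQ, hSQdef⟩ : ∃ S, ∑ w, deg D w * deg D w = S := ⟨_, rfl⟩
  rw [hPudef] at hPu hc1 hdegsum hTg hsq
  rw [hPvdef] at hPv hc2 hdegsum hTg hsq
  rw [hTgdef] at hTg hsq
  rw [hTfgdef] at hTfg hsq
  rw [hmdef] at hm hdegsum ⊢
  rw [hSQdef] at hsq ⊢
  rw [hsub1, hsub2, hcardV]
  by_cases huv' : D.Adj u v
  · -- `u ∼ v`
    right
    rw [if_pos huv'] at hdegsum hsq
    have hcle : c ≤ 1 := by rw [← hc]; exact card_both_le_one_of_adj D hK huv' N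
    have hPuv : Pu + Pv ≤ K + 1 := by
      have := degIn_add_degIn_le_of_adj_pair D hK N huv'
      rw [hPudef, hPvdef, hKdef] at this
      exact this
    clear hsqN hsumN hsplit hTf hTgg hdegN hdegu hdegv hRu hRv hPudef hPvdef hTgdef hTfgdef hmdef hSQdef hc
      hmemN hmemR hN hR hRuv hdx hf1 hM hKdef hxN hcardV hk hx
    obtain ⟨α, hα⟩ : ∃ α, Pu + M + α = K := ⟨K - Pu - M, by omega⟩
    obtain ⟨β, hβ⟩ : ∃ β, Pv + M + β = K := ⟨K - Pv - M, by omega⟩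
    have hr : α + β + M = r + 1 := by omega
    have hM2 : 2 ≤ M := by omega
    refine ⟨by omega, ?_⟩
    have harith := three_row_cap_arith_adj K r s m M Pu Pv α β c hs (by omega) hα hβ hr hcle hM2
    rw [hsq]
    linarith [harith, hTfg, hTg]
  · -- `u ≁ v`
    rw [if_neg huv'] at hdegsum hsq
    rcases Nat.eq_zero_or_pos M with hM0 | hMpos
    · -- no matching edge: `D ⊆ K({x, u, v}, N)`
      left
      refine ⟨{x, u, v}, ?_, ?_⟩
      · rw [card_insert_of_notMem, card_pair huv]
        rw [mem_insert, mem_singleton]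
        rintro (h | h)
        · exact hu.1 h.symm
        · exact hv.1 h.symm
      · have hnoN : ∀ y ∈ N, ∀ y', D.Adj y y' → y' ∉ N := by
          intro y hy y' hyy' hy'
          have h0 : degIn D N y = 0 := by
            have hle : degIn D N y ≤ ∑ z ∈ N, degIn D N z := single_le_sum (fun _ _ => Nat.zero_le _) hy
            rw [hTf, hM0, mul_zero] at hle
            exact Nat.le_zero.mp hle
          unfold degIn at h0
          rw [card_eq_zero, filter_eq_empty_iff] at h0
          exact h0 hy' hyy'
        have hmem : ∀ w, w ∈ ({x, u, v} : Finset V) ↔ w = x ∨ w = u ∨ w = v := by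
          intro w
          simp only [mem_insert, mem_singleton]
        have hNA : ∀ w, w ∈ N → w ∉ ({x, u, v} : Finset V) := by
          intro w hw hwA
          rw [hmem] at hwA
          rcases hwA with rfl | rfl | rfl
          · exact hxN hw
          · exact hu.2 ((hmemN w).mp hw)
          · exact hv.2 ((hmemN w).mp hw)
        have hAN : ∀ w, w ∉ N → w ∈ ({x, u, v} : Finset V) := by
          intro w hw
          rw [hmem]
          by_cases hwx : w = x
          · exact Or.inl hwx
          have : w ∈ R := (hmemR w).mpr ⟨hwx, fun h => hw ((hmemN w).mpr h)⟩
          rw [hRuv, mem_insert, mem_singleton] at this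
          exact Or.inr this
        have hAA : ∀ a ∈ ({x, u, v} : Finset V), ∀ b ∈ ({x, u, v} : Finset V), ¬ D.Adj a b := by
          intro a ha b hb hab
          rw [hmem] at ha hb
          rcases ha with rfl | rfl | rfl <;> rcases hb with rfl | rfl | rfl
          · exact D.irrefl hab
          · exact hu.2 hab
          · exact hv.2 hab
          · exact hu.2 (D.adj_symm hab)
          · exact D.irrefl hab
          · exact huv' hab
          · exact hv.2 (D.adj_symm hab)
          · exact huv' (D.adj_symm hab)
          · exact D.irrefl hab
        intro a b hab
        by_cases haA : a ∈ ({x, u, v} : Finset V)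
        · have hbA : b ∉ ({x, u, v} : Finset V) := fun hbA => hAA a haA b hbA hab
          exact ⟨fun _ => hbA, fun _ => haA⟩
        · have haN : a ∈ N := by
            by_contra h
            exact haA (hAN a h)
          have hbN : b ∉ N := hnoN a haN b hab
          have hbA : b ∈ ({x, u, v} : Finset V) := hAN b hbN
          exact ⟨fun h => absurd h haA, fun h => absurd hbA h⟩
    · -- a matching edge: the gap is at least `2 (k − 7)`
      right
      clear hsqN hsumN hsplit hTf hTgg hdegN hdegu hdegv hRu hRv hPudef hPvdef hTgdef hTfgdef hmdef hSQdef hc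
        hmemN hmemR hN hR hRuv hdx hf1 hM hKdef hxN hcardV hk hx
      obtain ⟨α, hα⟩ : ∃ α, Pu + M + α = K := ⟨K - Pu - M, by omega⟩
      obtain ⟨β, hβ⟩ : ∃ β, Pv + M + β = K := ⟨K - Pv - M, by omega⟩
      have hr : α + β + M = r := by omega
      refine ⟨by omega, ?_⟩
      have harith := three_row_cap_arith_not_adj K r s m M Pu Pv α β c hs (by omega) hα hβ hr hc1 hc2 hMpos
      rw [hsq]
      linarith [harith, hTfg, hTg]

end C047

end TriangleCap

end PercRepro
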